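import Literature.AlgebraicGeometry.Resolution.RsopMonomialIdeals
import Literature.AlgebraicGeometry.Resolution.RegularSystemOfParameters
import Literature.AlgebraicGeometry.Resolution.QuasiRegularSequences
import Mathlib.RingTheory.Ideal.Height
import Mathlib.RingTheory.KrullDimension.NonZeroDivisors
import Mathlib.RingTheory.Localization.LocalizationLocalization
import Mathlib.RingTheory.Localization.Ideal
import HarnessLib

/-!
# The order of an element along a prime is generically constant on its regular locus

Topic: `Literature/AlgebraicGeometry/Resolution`. Let `A` be a regular (Noetherian) ring, `𝔭` a
prime ideal, and `f ∈ A` of order exactly `m` along `𝔭` (`s f ∈ 𝔭ᵐ` for some `s ∉ 𝔭`, and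
`s f ∉ 𝔭ᵐ⁺¹` for all `s ∉ 𝔭`, i.e. `f ∈ 𝔭⁽ᵐ⁾ ∖ 𝔭⁽ᵐ⁺¹⁾`). Suppose `V(𝔭)` is generically regular:
`A_𝔮/𝔭A_𝔮` is a regular local ring for all primes `𝔮 ⊇ 𝔭` off some `g₀ ∉ 𝔭` (as guaranteed by
excellence, condition J-2). **Theorem** (`exists_not_mem_forall_mul_not_mem_pow`): there is
`g ∉ 𝔭` such that for every prime `𝔮 ⊇ 𝔭` with `g ∉ 𝔮` the order of `f` at `𝔮` is still `≤ m`
(`t f ∉ 𝔮ᵐ⁺¹` for all `t ∉ 𝔮`). Together with `OrderGenerization.lean` (`ord_𝔮 f ≥ ord_𝔭 f`) this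
says that `ord_𝔮 f = m` on a dense open subset of `V(𝔭)` — the constructibility half of
"`Σ := {x ∈ X | m(x) = μ}` … is a closed subset of `X`" in the proof of Cossart–Piltant 2008,
Prop. 4.2, along a curve `V(𝔭)`.

## Proof (initial form along `𝔭`)

Lift a regular system of parameters of `A_𝔭` to `y₁, …, y_r ∈ 𝔭`; off some `g₂ ∉ 𝔭`,
`𝔭A_𝔮 = (y)A_𝔮`. Write `s f = F(y)` for a form `F` of degree `m` over `A`; as `f ∉ 𝔭⁽ᵐ⁺¹⁾` some
coefficient `a = F_α` is not in `𝔭`. Put `g = g₀ g₂ s a`. At `𝔮 ⊇ 𝔭` with `g ∉ 𝔮`, the local ring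
`R = A_𝔮` is regular, `P = 𝔭R = (y)` has regular quotient and `dim R/P + r ≤ dim R` (`r = ht 𝔭`),
so `y` is part of a regular system of parameters of `R` (`IsRsopPart.of_isRegularLocalRing_quotient`,
Matsumura 14.2); if `t f ∈ 𝔮ᵐ⁺¹` then `F(y) ∈ 𝔪_Rᵐ⁺¹`, whence all coefficients of `F` lie in
`𝔪_R` by quasi-regularity (Matsumura 17.10), contradicting `a ∉ 𝔮`.

## References

* V. Cossart, O. Piltant, J. Algebra 320 (2008), proof of Prop. 4.2. [cite: CossartPiltant2008, Prop. 4.2 (proof)]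
* H. Matsumura, *Commutative Ring Theory*, Thm. 14.2, Thm. 17.10. [cite: Matsumura1987, Thm. 14.2]
-/

noncomputable section

open IsLocalRing MvPolynomial

namespace Literature.AlgebraicGeometry.Resolution

universe u

/-! ## Dimension bookkeeping -/

section Dim

variable {R : Type u} [CommRing R]

/-- `dim R/P + ht P ≤ dim R` for a prime `P` (chains below and above `P` concatenate).
[folklore] -/
theorem ringKrullDim_quotient_add_natCast_le_of_height_eq (P : Ideal R) [P.IsPrime] {r : ℕ}
    (hr : P.height = r) : ringKrullDim (R ⧸ P) + r ≤ ringKrullDim R := by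
  let a : PrimeSpectrum R := ⟨P, ‹_›⟩
  have hzero : PrimeSpectrum.zeroLocus (R := R) (P : Set R) = Set.Ici a := by
    ext x
    rw [PrimeSpectrum.mem_zeroLocus, Set.mem_Ici]
    rfl
  have hq : ringKrullDim (R ⧸ P) = (Order.coheight a : ℕ∞) := by
    rw [ringKrullDim_quotient, hzero, ← Order.coheight_eq_krullDim_Ici]
  have hh : Order.height a = r := by
    have := PrimeSpectrum.height_eq_orderHeight a
    rw [← this]
    exact hr
  haveI : Nonempty (PrimeSpectrum R) := ⟨a⟩
  have hle : ((Order.height a + Order.coheight a : ℕ∞) : WithBot ℕ∞) ≤ ringKrullDim R := by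
    rw [ringKrullDim, Order.krullDim_eq_iSup_height_add_coheight_of_nonempty]
    exact_mod_cast le_iSup (fun b : PrimeSpectrum R => Order.height b + Order.coheight b) a
  rw [hq]
  calc ((Order.coheight a : ℕ∞) : WithBot ℕ∞) + r
      = ((Order.height a + Order.coheight a : ℕ∞) : WithBot ℕ∞) := by
        rw [hh, add_comm]; rfl
    _ ≤ ringKrullDim R := hle

end Dim

/-! ## Lifting a regular system of parameters of `A_𝔭` -/

section Lift

variable {A : Type u} [CommRing A] [IsNoetherianRing A] (𝔭 : Ideal A) [𝔭.IsPrime]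

omit [IsNoetherianRing A] in
/-- **Lifting a regular system of parameters of `A_𝔭` to elements of `𝔭`.** [folklore] -/
theorem exists_lift_rsop [IsRegularLocalRing (Localization.AtPrime 𝔭)] :
    ∃ (r : ℕ) (y : Fin r → A), (maximalIdeal (Localization.AtPrime 𝔭)).spanFinrank = r ∧
      (∀ i, y i ∈ 𝔭) ∧
      Ideal.span (Set.range fun i => algebraMap A (Localization.AtPrime 𝔭) (y i)) =
        maximalIdeal (Localization.AtPrime 𝔭) := by
  obtain ⟨ybar, hybar⟩ := exists_regularSystemOfParameters (R := Localization.AtPrime 𝔭)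
  refine ⟨_, fun i => (IsLocalization.surj 𝔭.primeCompl (ybar i)).choose.1, rfl, fun i => ?_, ?_⟩
  · have h := (IsLocalization.surj 𝔭.primeCompl (ybar i)).choose_spec
    have hmem : algebraMap A (Localization.AtPrime 𝔭)
        (IsLocalization.surj 𝔭.primeCompl (ybar i)).choose.1 ∈
          maximalIdeal (Localization.AtPrime 𝔭) := by
      rw [← h]
      exact Ideal.mul_mem_right _ _ (hybar ▸ Ideal.subset_span ⟨i, rfl⟩)
    exact (IsLocalization.AtPrime.to_map_mem_maximal_iff (Localization.AtPrime 𝔭) 𝔭 _).mp hmem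
  · refine (Ideal.span_range_eq_of_associated fun i => ?_).trans hybar
    have h := (IsLocalization.surj 𝔭.primeCompl (ybar i)).choose_spec
    rw [← h]
    exact (associated_mul_unit_right _ _
      (IsLocalization.map_units _ (IsLocalization.surj 𝔭.primeCompl (ybar i)).choose.2)).symm

/-- **Off some `g₂ ∉ 𝔭`, the lifts generate `𝔭` locally**: `𝔭A_𝔮 = (y)A_𝔮` for all primes
`𝔮 ⊇ 𝔭` with `g₂ ∉ 𝔮`. [folklore] -/
theorem exists_not_mem_forall_map_eq_span {r : ℕ} (y : Fin r → A) (hy : ∀ i, y i ∈ 𝔭)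
    (hspan : Ideal.span (Set.range fun i => algebraMap A (Localization.AtPrime 𝔭) (y i)) =
      maximalIdeal (Localization.AtPrime 𝔭)) :
    ∃ g₂ ∉ 𝔭, ∀ (𝔮 : Ideal A) [𝔮.IsPrime], 𝔭 ≤ 𝔮 → g₂ ∉ 𝔮 →
      𝔭.map (algebraMap A (Localization.AtPrime 𝔮)) =
        Ideal.span (Set.range fun i => algebraMap A (Localization.AtPrime 𝔮) (y i)) := by
  classical
  obtain ⟨G, hG⟩ := (inferInstance : IsNoetherianRing A).noetherian 𝔭
  -- each generator of `𝔭` lies in `(y)` after multiplying by some `t ∉ 𝔭`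
  have hgen : ∀ p ∈ G, ∃ t ∈ 𝔭.primeCompl, t * p ∈ Ideal.span (Set.range y) := by
    intro p hp
    have hp𝔭 : p ∈ 𝔭 := hG ▸ Ideal.subset_span hp
    have h1 : algebraMap A (Localization.AtPrime 𝔭) p ∈
        (Ideal.span (Set.range y)).map (algebraMap A (Localization.AtPrime 𝔭)) := by
      rw [Ideal.map_span, ← Set.range_comp]
      change _ ∈ Ideal.span (Set.range fun i => algebraMap A (Localization.AtPrime 𝔭) (y i))
      rw [hspan]
      exact (IsLocalization.AtPrime.to_map_mem_maximal_iff (Localization.AtPrime 𝔭) 𝔭 _).mpr hp𝔭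
    exact (IsLocalization.algebraMap_mem_map_algebraMap_iff 𝔭.primeCompl _ _ _).mp h1
  choose t ht htp using hgen
  refine ⟨∏ p ∈ G.attach, t p.1 p.2, ?_, fun 𝔮 _ h𝔭𝔮 hg𝔮 => ?_⟩
  · exact Submonoid.prod_mem 𝔭.primeCompl fun p _ => ht p.1 p.2
  · have htq : ∀ p (hp : p ∈ G), t p hp ∉ 𝔮 := fun p hp h => hg𝔮
      (Ideal.mem_of_dvd 𝔮 (Finset.dvd_prod_of_mem (fun q : G => t q.1 q.2)
        (Finset.mem_attach G ⟨p, hp⟩)) h)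
    apply le_antisymm
    · rw [← hG, Ideal.map_span, Ideal.span_le]
      rintro _ ⟨p, hp, rfl⟩
      have hu : IsUnit (algebraMap A (Localization.AtPrime 𝔮) (t p hp)) :=
        IsLocalization.map_units _ (⟨t p hp, htq p hp⟩ : 𝔮.primeCompl)
      rw [SetLike.mem_coe, ← Ideal.unit_mul_mem_iff_mem _ hu, ← map_mul]
      have := Ideal.mem_map_of_mem (algebraMap A (Localization.AtPrime 𝔮)) (htp p hp)
      rwa [Ideal.map_span, ← Set.range_comp] at this
    · rw [Ideal.span_le]
      rintro _ ⟨i, rfl⟩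
      exact Ideal.mem_map_of_mem _ (hy i)

end Lift

/-! ## The theorem -/

/-- **The order along a prime is generically constant** (initial form criterion). Let `A` be a
regular ring, `𝔭` a prime, `f ∈ A` with `s f ∈ 𝔭ᵐ` for some `s ∉ 𝔭` and `s f ∉ 𝔭ᵐ⁺¹` for all
`s ∉ 𝔭` (order exactly `m` along `𝔭`), and suppose `A_𝔮/𝔭A_𝔮` is regular for the primes
`𝔮 ⊇ 𝔭` avoiding some `g₀ ∉ 𝔭`. Then there is `g ∉ 𝔭` such that `t f ∉ 𝔮ᵐ⁺¹` for every prime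
`𝔮 ⊇ 𝔭` with `g ∉ 𝔮` and every `t ∉ 𝔮` (order `≤ m` at `𝔮`).
[cite: CossartPiltant2008, Prop. 4.2 (proof)] -/
theorem exists_not_mem_forall_mul_not_mem_pow {A : Type u} [CommRing A] [IsRegularRing A]
    (𝔭 : Ideal A) [𝔭.IsPrime] {f : A} {m : ℕ}
    (hfm : ∃ s ∉ 𝔭, s * f ∈ 𝔭 ^ m) (hfm1 : ∀ s ∉ 𝔭, s * f ∉ 𝔭 ^ (m + 1))
    (hreg : ∃ g₀ ∉ 𝔭, ∀ (𝔮 : Ideal A) [𝔮.IsPrime], 𝔭 ≤ 𝔮 → g₀ ∉ 𝔮 →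
      IsRegularLocalRing (Localization.AtPrime 𝔮 ⧸ 𝔭.map (algebraMap A (Localization.AtPrime 𝔮)))) :
    ∃ g ∉ 𝔭, ∀ (𝔮 : Ideal A) [𝔮.IsPrime], 𝔭 ≤ 𝔮 → g ∉ 𝔮 → ∀ t ∉ 𝔮, t * f ∉ 𝔮 ^ (m + 1) := by
  classical
  haveI : IsNoetherianRing A := inferInstance
  obtain ⟨g₀, hg₀, hreg⟩ := hreg
  -- lift a regular system of parameters of `A_𝔭`
  obtain ⟨r, y, hr, hy, hspan⟩ := exists_lift_rsop 𝔭
  obtain ⟨g₂, hg₂, hgen⟩ := exists_not_mem_forall_map_eq_span 𝔭 y hy hspan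
  -- `s f = F(y)` for a form of degree `m`, with a coefficient outside `𝔭`
  obtain ⟨s₀, hs₀, hs₀f⟩ := hfm
  have h1 : algebraMap A (Localization.AtPrime 𝔭) (s₀ * f) ∈
      (Ideal.span (Set.range y) ^ m).map (algebraMap A (Localization.AtPrime 𝔭)) := by
    rw [Ideal.map_pow, Ideal.map_span, ← Set.range_comp]
    change _ ∈ Ideal.span (Set.range fun i => algebraMap A (Localization.AtPrime 𝔭) (y i)) ^ m
    rw [hspan, ← IsLocalization.AtPrime.map_eq_maximalIdeal 𝔭 (Localization.AtPrime 𝔭),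
      ← Ideal.map_pow]
    exact Ideal.mem_map_of_mem _ hs₀f
  obtain ⟨s₁, hs₁, hs₁f⟩ := (IsLocalization.algebraMap_mem_map_algebraMap_iff 𝔭.primeCompl _ _ _).mp h1
  set s := s₁ * s₀ with hs
  have hs𝔭 : s ∉ 𝔭 := fun h => (Ideal.IsPrime.mem_or_mem ‹_› h).elim hs₁ hs₀
  have hsf : s * f ∈ Ideal.span (Set.range y) ^ m := by rw [hs, mul_assoc]; exact hs₁f
  obtain ⟨F, hF, hFy⟩ := exists_isHomogeneous_of_mem_span_pow y m hsf
  have hcoeff : ∃ α, F.coeff α ∉ 𝔭 := by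
    by_contra hall
    push Not at hall
    have hFK : F ∈ Ideal.map (C : A →+* MvPolynomial (Fin r) A) 𝔭 := by
      rw [mem_map_C_iff]; exact hall
    have h2 := eval_mem_mul_span_pow y hF hFK
    rw [hFy] at h2
    have h3 : 𝔭 * Ideal.span (Set.range y) ^ m ≤ 𝔭 ^ (m + 1) := by
      rw [pow_succ']
      exact Ideal.mul_mono_right (Ideal.pow_right_mono (Ideal.span_le.mpr (by
        rintro _ ⟨i, rfl⟩; exact hy i)) m)
    exact hfm1 s hs𝔭 (h3 h2)
  obtain ⟨α, hα⟩ := hcoeff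
  -- the good open set
  refine ⟨g₀ * g₂ * s * F.coeff α, ?_, fun 𝔮 _ h𝔭𝔮 hg𝔮 t ht htf => ?_⟩
  · intro h
    rcases Ideal.IsPrime.mem_or_mem ‹_› h with h | h
    · rcases Ideal.IsPrime.mem_or_mem ‹_› h with h | h
      · rcases Ideal.IsPrime.mem_or_mem ‹_› h with h | h
        · exact hg₀ h
        · exact hg₂ h
      · exact hs𝔭 h
    · exact hα h
  -- at `𝔮`: `g₀, g₂, s, F_α ∉ 𝔮`
  have hg₀q : g₀ ∉ 𝔮 := fun h => hg𝔮 (by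
    have : g₀ * g₂ * s * F.coeff α = g₀ * (g₂ * s * F.coeff α) := by ring
    rw [this]; exact Ideal.mul_mem_right _ _ h)
  have hg₂q : g₂ ∉ 𝔮 := fun h => hg𝔮 (by
    have : g₀ * g₂ * s * F.coeff α = g₂ * (g₀ * s * F.coeff α) := by ring
    rw [this]; exact Ideal.mul_mem_right _ _ h)
  have hsq : s ∉ 𝔮 := fun h => hg𝔮 (by
    have : g₀ * g₂ * s * F.coeff α = s * (g₀ * g₂ * F.coeff α) := by ring
    rw [this]; exact Ideal.mul_mem_right _ _ h)
  have hαq : F.coeff α ∉ 𝔮 := fun h => hg𝔮 (Ideal.mul_mem_left _ _ h)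
  -- the regular local ring `R = A_𝔮` and the part `z = y/1` of a regular system of parameters
  set R := Localization.AtPrime 𝔮 with hR
  haveI : IsRegularLocalRing R := inferInstance
  set z : Fin r → R := fun i => algebraMap A R (y i) with hz
  have hPz : 𝔭.map (algebraMap A R) = Ideal.span (Set.range z) := hgen 𝔮 h𝔭𝔮 hg₂q
  haveI hPp : (𝔭.map (algebraMap A R)).IsPrime :=
    IsLocalization.isPrime_of_isPrime_disjoint 𝔮.primeCompl R 𝔭 ‹_›
      (Set.disjoint_left.mpr fun _ ha ha𝔭 => ha (h𝔭𝔮 ha𝔭))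
  haveI : (Ideal.span (Set.range z)).IsPrime := hPz ▸ hPp
  haveI : IsRegularLocalRing (R ⧸ 𝔭.map (algebraMap A R)) := hreg 𝔮 h𝔭𝔮 hg₀q
  haveI : IsRegularLocalRing (R ⧸ Ideal.span (Set.range z)) :=
    IsRegularLocalRing.of_ringEquiv (Ideal.quotEquivOfEq hPz)
  -- `ht (y)A_𝔮 = ht 𝔭 = r`
  have hzm : ∀ i, z i ∈ maximalIdeal R := fun i =>
    (IsLocalization.AtPrime.to_map_mem_maximal_iff R 𝔮 _).mpr (h𝔭𝔮 (hy i))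
  have hht : (Ideal.span (Set.range z)).height = r := by
    rw [← hPz]
    -- `R_{𝔭R} = A_𝔭`, whose dimension is `ht 𝔭 = ht 𝔭R` and equals `r`
    have hcomap : (𝔭.map (algebraMap A R)).comap (algebraMap A R) = 𝔭 :=
      IsLocalization.under_map_of_isPrime_disjoint 𝔮.primeCompl R ‹_›
        (Set.disjoint_left.mpr fun _ ha ha𝔭 => ha (h𝔭𝔮 ha𝔭))
    haveI := IsLocalization.isLocalization_atPrime_localization_atPrime 𝔮.primeCompl
      (𝔭.map (algebraMap A R))
    have hd1 := IsLocalization.AtPrime.ringKrullDim_eq_height (𝔭.map (algebraMap A R))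
      (Localization.AtPrime (𝔭.map (algebraMap A R)))
    have hd2 := IsLocalization.AtPrime.ringKrullDim_eq_height
      ((𝔭.map (algebraMap A R)).comap (algebraMap A (Localization 𝔮.primeCompl)))
      (Localization.AtPrime (𝔭.map (algebraMap A R)))
    have hh : ((𝔭.map (algebraMap A R)).comap (algebraMap A (Localization 𝔮.primeCompl))).height =
        𝔭.height := by
      change ((𝔭.map (algebraMap A R)).comap (algebraMap A R)).height = 𝔭.height
      rw [hcomap]
    have hd3 := IsLocalization.AtPrime.ringKrullDim_eq_height 𝔭 (Localization.AtPrime 𝔭)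
    have hreg𝔭 := (inferInstance : IsRegularLocalRing (Localization.AtPrime 𝔭)).spanFinrank_maximalIdeal
    rw [hr, hd3] at hreg𝔭
    have : ((𝔭.map (algebraMap A R)).height : WithBot ℕ∞) = (r : WithBot ℕ∞) := by
      rw [← hd1, hd2, hh, ← hreg𝔭]
    exact_mod_cast this
  have hdim : ringKrullDim (R ⧸ Ideal.span (Set.range z)) + r ≤ ringKrullDim R :=
    ringKrullDim_quotient_add_natCast_le_of_height_eq _ hht
  have hrsop : IsRsopPart z := IsRsopPart.of_isRegularLocalRing_quotient hzm hdim
  obtain ⟨e, x, hd, hx, hxz⟩ := hrsop.exists_rsop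
  -- the form `F` in the variables `x`, evaluated: `(s f)/1 ∈ 𝔪_R^{m+1}`
  set F' : MvPolynomial (Fin (r + e)) R :=
    MvPolynomial.rename (Fin.castAdd e) (MvPolynomial.map (algebraMap A R) F) with hF'
  have hF'hom : F'.IsHomogeneous m := (hF.map (algebraMap A R)).rename_isHomogeneous
  have hevalF' : MvPolynomial.eval x F' = algebraMap A R (s * f) := by
    rw [hF', MvPolynomial.eval_rename, MvPolynomial.eval_map, ← hFy]
    change MvPolynomial.eval₂ (algebraMap A R) (x ∘ Fin.castAdd e) F =
      algebraMap A R (MvPolynomial.eval₂Hom (RingHom.id A) y F)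
    rw [MvPolynomial.map_eval₂Hom, RingHom.comp_id, MvPolynomial.coe_eval₂Hom]
    congr 1
    funext i
    exact hxz i
  have hmem : MvPolynomial.eval x F' ∈ maximalIdeal R ^ (m + 1) := by
    rw [hevalF', ← IsLocalization.AtPrime.map_eq_maximalIdeal 𝔮 R, ← Ideal.map_pow]
    have hu : IsUnit (algebraMap A R t) := IsLocalization.map_units R (⟨t, ht⟩ : 𝔮.primeCompl)
    have hu' : IsUnit (algebraMap A R s) := IsLocalization.map_units R (⟨s, hsq⟩ : 𝔮.primeCompl)
    rw [map_mul, Ideal.unit_mul_mem_iff_mem _ hu', ← Ideal.unit_mul_mem_iff_mem _ hu, ← map_mul]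
    exact Ideal.mem_map_of_mem _ htf
  -- quasi-regularity: all coefficients of `F'` lie in `𝔪_R`
  have hcoeffs := coeff_mem_maximalIdeal_of_eval_mem_pow hd x hx hF'hom hmem
    (Finsupp.mapDomain (Fin.castAdd e) α)
  rw [hF', MvPolynomial.coeff_rename_mapDomain _ (Fin.castAdd_injective _ _),
    MvPolynomial.coeff_map] at hcoeffs
  exact hαq ((IsLocalization.AtPrime.to_map_mem_maximal_iff R 𝔮 _).mp hcoeffs)

end Literature.AlgebraicGeometry.Resolution

end
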